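import Mathlib
import Literature.MathematicalPhysics.QuantumFieldTheory.Balaban1983to89.B6RandomWalk

/-!
# `Balaban1983to89.B11B3` — the constant B₃ of (162) in B11: "B₃ depends on d and L only", kernel-checked as a
multiscale scale-sum bound from Lemma 2.1 of [3] plus a LOCATED smallness relation

T. Bałaban, *The variational problem and background fields in renormalization group method for lattice gauge
theories*, Commun. Math. Phys. **102**, 277–309 (1985) [Balaban1985Variational] (cell paper B11; PDF held
`paper:balaban1985-cmp102-variational-background`, journal page = PDF page + 276).  Sibling of `…Balaban1983to89.B11`
(units b2b-balaban-r1 / b11 / pv12 — UNTOUCHED: its Sect. F leaves `B11.SectFPrinted`, `B11.B3_lower_bounds` are neither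
restated nor concluded here; this module treats the ONE sentence after (162) that `…B11` types by name only) and of
`…Balaban1983to89.B6`, `…B6RandomWalk` (Lemma 2.1 of [3] = [Balaban1984PropagatorsII]: `B6.Lemma21Printed`,
`B6RandomWalk.Ineq260`, `B6RandomWalk.Ineq261`, `B6.c1`, `B6.Cond259`, the carrier `B6.Geometry` — reused BY NAME).

CITATION HEADER (lean-in-tree rule 2026-08-18).  This module is a KERNEL-CHECKED BOOKKEEPING STEP of the published
paper [Balaban1985Variational], p. 303 [PDF 27], verbatim (end of the chain (161) and the definition (162)):
*"≦ 18d³L³B₀ Σ_{y₂∈ℭ_k} e^{−(1/2)δ₀d(y₁,y₂)}(d(y₁,y₂) + 1)(L^{j₂}η)^{−1} · M_Δ max{ε₁, e^{−(1/2)δ₀R₁M₁}ε₀},  (161)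
where y₁ ∈ Δ, and M_Δ = 1 for Δ = Δ₀, M_Δ = M for Δ = □. It is now clear how we should define B₃. Let us take
B₃ = 72d³L³B₀ sup_{ℭ_k} sup_{y₁} Σ_{y₂∈ℭ_k} e^{−1/2δ₀d(y₁,y₂)}(d(y₁,y₂) + 1)(L^{j₂}η)^{−1}.  (162)
It follows from the inequalities (2.47)–(2.51) of [3] that B₃ depends on d and L only."*
Here [3] = [Balaban1984PropagatorsII] (reference list p. 309 [PDF 33]); its (2.47)–(2.51), pp. 231–232 [PDF 9–10], are,
verbatim in kind: (2.47) the decomposition of an admissible contour Γ_{y,y′} at the separating surfaces Σ_j; (2.48) the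
resulting lower bound for the multiscale distance d(y,y′) of (2.46); (2.49) *"|Rλ| ≦ O(M^{−1})|λ|"*; (2.50) the Neumann /
random-walk expansion of G′ = G′₀(I − R)^{−1}; (2.51) *"|(Rλ)(x)| ≦ O(M^{−1})e^{−δ₀d(x,y)}|λ| if supp λ ⊂ B^j(y), y ∈ Λ_j"*.
The finite-sum statements these feed are Lemma 2.1 of [3], p. 234 [PDF 12] (verbatim in `B6.Lemma21Printed`):
(2.60) *"e^{−αδ₀d(y,y′)} ≦ e^{−αδ₀RM max{|j−j′|−1,0}}, y ∈ Λ_j, y′ ∈ Λ_{j′}"* and (2.61) *"sup_{y∈𝔅} Σ_{y′∈𝔅} e^{−αδ₀d(y,y′)}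
≦ c₁(α)"*, for 0 < α < 1 and RM satisfying (2.59).  The multiscale set here is ℭ_k of (148) p. 301 [PDF 25] (the set 𝔅
of [3] (2.45) built on the sequence {Ω′_j} = {□_j (j ≤ k−1), □″_k} of (144)/(148), with the parameters R₁, M₁ of
[Balaban1985RegularSpaces] p. 98 [PDF 24], verbatim: *"R₁, M₁ are smallest integers for which all the theorems of the
papers [2, 4] are valid"* … *"R₁, M₁ are absolute constants"*), (L^{j₂}η)^{−1} is the inverse block length of y₂ ∈ Λ′_{j₂}
(`B6.Geometry.len`), and η = L^{−k} ((5) p. 278 [PDF 2], verbatim *"η = L^{−k}"*; Sect. F p. 300 [PDF 24]: *"For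
simplicity of notations we assume that j = k, a general case can be obtained by obvious rescalings"*), so L^kη = 1 —
typed as the weaker `1 ≤ L^k·η`.

WHAT IS REPRODUCED (0 sorry): the derivation the print delegates to "(2.47)–(2.51) of [3]" and does not display (cell
GAPS row G-B11-F2: "B₃ depends on d and L only" asserted by reference).  Over the tree carrier `B6.Geometry`
(one geometry = one situation (k; ℭ_k); a family `geo : I → B6.Geometry` = all of them for fixed d, L):
* `term162`, `sum162` — the summand and the inner sum of (162), verbatim; `Claim162` — the printed claim "the double
  supremum is finite (one constant for the whole family)" as a Prop (NOT asserted);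
* `sum162_le` — KERNEL: if (i) the (2.60)-consequence d(y₁,y₂) ≥ RM·(k − j₂ − g) holds on ℭ_k (g = the scale allowance
  of the observation point: y₁ ∈ Δ ⊂ □ sits at scale k or k − 1 of {Ω′_j}, so g ≤ 2; from (2.60) by `dist_lower_of_ineq260`),
  (ii) the (2.61)-shaped row sum at a rate cδ₀ is ≤ C₁, and (iii) the SMALLNESS `L·e^{−aδ₀RM} ≤ 1`, with a + b + c ≤ ½,
  then `sum162 ≤ L^g · (1/(e·bδ₀) + 1) · C₁` — uniformly in k, ℭ_k, y₁: the factor L^{k−j₂} = (L^{j₂}η)^{−1} is paid by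
  e^{−aδ₀d} through the layer separations ((2.60): every scale step costs distance RM), the factor (d + 1) by e^{−bδ₀d}
  (`add_one_mul_exp_neg_le`: (t+1)e^{−st} ≤ 1/(es) + 1), and the sum by (2.61) at rate cδ₀;
* `sum162_le_of_lemma21`, `claim162_of_lemma21` — the instance (a,b,c) = (¼,⅛,⅛) with (2.60), (2.61) DISCHARGED from the
  tree's `B6.Lemma21Printed d δ₀ geo` (a hypothesis) at α = ⅛: under (2.59) at α = ⅛ (`B6.Cond259 d δ₀ (1/8) R M`) and
  ¼δ₀RM ≥ log L, `sum162 ≤ L^g(8/(eδ₀) + 1)c₁(⅛)`, hence `Claim162` with S = L^g(8/(eδ₀)+1)c₁(⅛) — a function of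
  (d, L, δ₀) only, δ₀ being the [3]-rate (itself (d, L)-determined, [3] Prop. 2.1/2.2);
* `ineq161_le_quarter_B3` — the arithmetic 72 = 4·18 by which (161) reads "≤ ¼B₃M_Δ max{ε₁, e^{−½δ₀R₁M₁}ε₀}" (the form
  used in (163)–(164), cell row C-B11-F1);
* `divergence_witness` — NECESSITY made kernel-visible: a single y₂ ∈ Λ′₀ at multiscale distance ≤ RM(k+1) + D₀ from y₁
  forces `sum162 ≥ e^{−½δ₀(RM+D₀)}·(L·e^{−½δ₀RM})^k`, so no k-uniform B₃ exists unless L·e^{−½δ₀R₁M₁} < 1 (up to the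
  polynomial factor), i.e. ½δ₀R₁M₁ > log L.

WHAT IS NOT REPRODUCED (hypotheses, each named — none is a cited fact): (i) Lemma 2.1 of [3] for the {Ω′_j}-geometry
of Sect. F (`B6.Lemma21Printed`, resp. the shapes `Ineq260`/`Ineq261`, as HYPOTHESES; the located divergence D-B6-01 of
`…B6` on (2.60) across non-adjacent regions is inherited, not re-adjudicated); (ii) the LOCATED SMALLNESS (cell rows
G-pv21-1 / SMALLNESS S-B11.7): k-uniformity of (162) needs, besides (2.59) of [3] at some rate α = c < ½, a relation
`aδ₀R₁M₁ ≥ log L` (a + c < ½) between the absolute constants R₁, M₁ and L — sufficient as typed here, and in the form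
½δ₀R₁M₁ > log L NECESSARY (`divergence_witness`); no such relation is displayed in [Balaban1985Variational] Sect. F, in
[Balaban1985RegularSpaces] p. 98, or in [3] (2.59) p. 233 (which bounds δ₀RM below by d-dependent constants only: at α = ½ it
reads δ₀RM > 16d log c₀(¼) + 8, `B6.cond259_half_iff`, so it implies ½δ₀RM > 4 ≥ log L only for L ≤ e⁴ ≈ 54.6) — an
implicit "R₁M₁ large compared with log L", recorded as a hypothesis binder, never as a fact; (iii) the geometric
dictionary (y₁ ↦ its block representative in ℭ_k, [3] p. 231 "d(x,x′) = d(y^j(x), y^{j′}(x′))"; ℭ_k ⊆ the site type as a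
`Finset`; scales ≤ k; d ≥ 0; L ≥ 1; η > 0) — explicit hypotheses (cell row D-pv21.1); (iv) the chain (161) itself and
(163)–(164) (`…B11`, cell row C-B11-F1) — untouched.  NOTHING of the series' end-statement (ultraviolet stability,
[Balaban1987RG1] Thm 2 ff., under adjudication by the cell `pub-balaban`) is asserted; value = kernel-checked
bookkeeping of a printed "it follows from … of [3]" plus a located implicit smallness relation, NOT summit progress.
Unit `b2b-balaban-pv21` (surge node prover #21), cell claim G-B11-F2-KERNEL; cell rows C-pv21-1 (certification),
G-pv21-1 (located smallness), D-pv21.1 (dictionary).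
-/

namespace Literature.MathematicalPhysics.QuantumFieldTheory.Balaban1983to89.B11B3

open Literature.MathematicalPhysics.QuantumFieldTheory.Balaban1983to89
open Finset

/-! ## (162): the summand, the inner sum, the printed claim -/

/-- The summand of (162) p. 303 [PDF 27], verbatim *"e^{−1/2δ₀d(y₁,y₂)}(d(y₁,y₂) + 1)(L^{j₂}η)^{−1}"*, over the tree carrier
`B6.Geometry` (d = `g.dist` = the multiscale distance (2.46) of [3]; (L^{j₂}η)^{−1} = `(g.len y₂)⁻¹`, y₂ ∈ Λ′_{j₂}).
[cite: Balaban1985Variational, (162) p.303] -/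
noncomputable def term162 (g : B6.Geometry) (δ₀ : ℝ) (y₁ y₂ : g.Site) : ℝ :=
  Real.exp (-(δ₀ / 2 * g.dist y₁ y₂)) * (g.dist y₁ y₂ + 1) * (g.len y₂)⁻¹

/-- The inner sum of (162), verbatim *"Σ_{y₂∈ℭ_k} e^{−1/2δ₀d(y₁,y₂)}(d(y₁,y₂) + 1)(L^{j₂}η)^{−1}"* (ℭ_k = (148) p. 301, a
finite set of multiscale points: `C : Finset g.Site`). [cite: Balaban1985Variational, (162) p.303] -/
noncomputable def sum162 (g : B6.Geometry) (δ₀ : ℝ) (C : Finset g.Site) (y₁ : g.Site) : ℝ :=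
  ∑ y₂ ∈ C, term162 g δ₀ y₁ y₂

/-- **The claim after (162)** (p. 303 [PDF 27], verbatim): *"B₃ = 72d³L³B₀ sup_{ℭ_k} sup_{y₁} Σ_{y₂∈ℭ_k}
e^{−1/2δ₀d(y₁,y₂)}(d(y₁,y₂) + 1)(L^{j₂}η)^{−1}. (162)  It follows from the inequalities (2.47)–(2.51) of [3] that B₃
depends on d and L only."* — typed as: ONE real S majorises the inner sum for every situation `i` of the family (every k
and ℭ_k for fixed d, L), every admissible observation point y₁ (`adm i y₁`: y₁ ∈ Δ ⊂ □, (161)) and every finite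
ℭ ⊆ ℭ_k; then B₃ := 72d³L³B₀·S.  A Prop, NOT asserted; concluded from hypotheses in `claim162_of_lemma21`.
[cite: Balaban1985Variational, (162) p.303] -/
def Claim162 {I : Type} (δ₀ : ℝ) (geo : I → B6.Geometry) (adm : (i : I) → (geo i).Site → Prop) : Prop :=
  ∃ S : ℝ, ∀ i : I, ∀ y₁ : (geo i).Site, adm i y₁ → ∀ C : Finset (geo i).Site, sum162 (geo i) δ₀ C y₁ ≤ S

/-! ## Elementary real inequalities -/

/-- `t·e^{−st} ≤ 1/(e·s)` for `s > 0` (from `x + 1 ≤ eˣ` at `x = st − 1`). [folklore] -/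
theorem mul_exp_neg_le {s : ℝ} (hs : 0 < s) (t : ℝ) :
    t * Real.exp (-(s * t)) ≤ 1 / (Real.exp 1 * s) := by
  have he : 0 < Real.exp 1 := Real.exp_pos 1
  have hE : 0 < Real.exp (s * t) := Real.exp_pos _
  have key : s * t * Real.exp 1 ≤ Real.exp (s * t) := by
    have h : s * t ≤ Real.exp (s * t - 1) := by linarith [Real.add_one_le_exp (s * t - 1)]
    rw [Real.exp_sub, le_div_iff₀ he] at h
    exact h
  rw [Real.exp_neg, ← div_eq_mul_inv, div_le_div_iff₀ hE (by positivity)]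
  have : t * (Real.exp 1 * s) = s * t * Real.exp 1 := by ring
  linarith

/-- `(t + 1)·e^{−st} ≤ 1/(e·s) + 1` for `s > 0`, `t ≥ 0`: the factor (d(y₁,y₂) + 1) of (162) against a fraction bδ₀ of the
decay rate. [folklore] -/
theorem add_one_mul_exp_neg_le {s t : ℝ} (hs : 0 < s) (ht : 0 ≤ t) :
    (t + 1) * Real.exp (-(s * t)) ≤ 1 / (Real.exp 1 * s) + 1 := by
  have h1 := mul_exp_neg_le hs t
  have h2 : Real.exp (-(s * t)) ≤ 1 := by
    rw [Real.exp_le_one_iff]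
    nlinarith
  have : (t + 1) * Real.exp (-(s * t)) = t * Real.exp (-(s * t)) + Real.exp (-(s * t)) := by ring
  linarith

/-- Scale compensation: with `L ≥ 1`, `L·q ≤ 1` and `x ≤ qⁿ` (`x, q ≥ 0`), `L^{g+n}·x ≤ L^g` — the factor
L^{k−j₂} = (L^{j₂}η)^{−1} of (162) is paid by the decay across the k − j₂ − g layer separations. [folklore] -/
theorem scale_compensation {L q x : ℝ} (hL : 1 ≤ L) (hq : 0 ≤ q) (hLq : L * q ≤ 1) (hx : 0 ≤ x)
    (gap n : ℕ) (hxq : x ≤ q ^ n) : L ^ (gap + n) * x ≤ L ^ gap := by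
  have hL0 : 0 < L := by linarith
  have h1 : L ^ n * x ≤ 1 :=
    calc L ^ n * x ≤ L ^ n * q ^ n := mul_le_mul_of_nonneg_left hxq (by positivity)
      _ = (L * q) ^ n := by rw [mul_pow]
      _ ≤ 1 := pow_le_one₀ (by positivity) hLq
  have hx' : 0 ≤ L ^ n * x := by positivity
  calc L ^ (gap + n) * x = L ^ gap * (L ^ n * x) := by rw [pow_add]; ring
    _ ≤ L ^ gap * 1 := mul_le_mul_of_nonneg_left h1 (by positivity)
    _ = L ^ gap := mul_one _

/-- `log L ≤ x ⇒ L·e^{−x} ≤ 1` (`L > 0`): the located smallness in its two spellings. [folklore] -/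
theorem smallness_of_log {L x : ℝ} (hL : 0 < L) (h : Real.log L ≤ x) : L * Real.exp (-x) ≤ 1 := by
  have hLx : L ≤ Real.exp x :=
    calc L = Real.exp (Real.log L) := (Real.exp_log hL).symm
      _ ≤ Real.exp x := Real.exp_le_exp.mpr h
  have hEx : 0 < Real.exp x := Real.exp_pos x
  rw [Real.exp_neg]
  calc L * (Real.exp x)⁻¹ ≤ Real.exp x * (Real.exp x)⁻¹ :=
        mul_le_mul_of_nonneg_right hLx (inv_pos.mpr hEx).le
    _ = 1 := mul_inv_cancel₀ hEx.ne'

/-! ## The kernel step: (2.60) + (2.61) + smallness ⇒ the sum of (162) is bounded uniformly in k -/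

/-- **KERNEL of "B₃ depends on d and L only"** (B11 p. 303 after (162), abstract form).  One geometry `g` (situation
(k; ℭ_k)), `ℭ ⊆ 𝔅` finite (`C`), an observation point y₁ whose scale allowance is `gap` (y₁ ∈ Δ ⊂ □: `gap ≤ 2`).
Hypotheses: `δ₀ > 0`; a split `a + b + c ≤ ½` of the rate (a, c ≥ 0, b > 0); `L ≥ 1`, `η > 0`, the normalisation
`L^kη ≥ 1` ((5) p. 278: η = L^{−k}) and scales ≤ k; d ≥ 0 on ℭ; **(2.60)-consequence** `RM·(k − j₂ − gap) ≤ d(y₁,y₂)`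
(`dist_lower_of_ineq260`, RM ≥ 0); **(2.61)-shape** `Σ_{y₂∈ℭ} e^{−cδ₀d(y₁,y₂)} ≤ C₁`; **located smallness**
`L·e^{−aδ₀RM} ≤ 1`.  Conclusion: `Σ_{y₂∈ℭ} e^{−½δ₀d}(d + 1)(L^{j₂}η)^{−1} ≤ L^{gap}·(1/(e·bδ₀) + 1)·C₁`.
[cite: Balaban1985Variational, (162) p.303; Balaban1984PropagatorsII, Lemma 2.1 (2.60)–(2.61) p.234] -/
theorem sum162_le (g : B6.Geometry) (δ₀ a b c C₁ : ℝ) (gap : ℕ) (C : Finset g.Site) (y₁ : g.Site)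
    (hδ₀ : 0 < δ₀) (ha : 0 ≤ a) (hb : 0 < b) (hc : 0 ≤ c) (habc : a + b + c ≤ 1 / 2)
    (hL : 1 ≤ g.L) (heta : 0 < g.eta) (hnorm : 1 ≤ g.L ^ g.k * g.eta)
    (hscale : ∀ y₂ ∈ C, g.scale y₂ ≤ g.k) (hdist : ∀ y₂ ∈ C, 0 ≤ g.dist y₁ y₂)
    (h60 : ∀ y₂ ∈ C, g.R * g.M * ((g.k : ℝ) - g.scale y₂ - gap) ≤ g.dist y₁ y₂)
    (h61 : ∑ y₂ ∈ C, Real.exp (-(c * δ₀ * g.dist y₁ y₂)) ≤ C₁)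
    (hsmall : g.L * Real.exp (-(a * δ₀ * (g.R * g.M))) ≤ 1) :
    sum162 g δ₀ C y₁ ≤ g.L ^ gap * (1 / (Real.exp 1 * (b * δ₀)) + 1) * C₁ := by
  have hL0 : 0 < g.L := by linarith
  set K : ℝ := g.L ^ gap * (1 / (Real.exp 1 * (b * δ₀)) + 1) with hK
  have hK0 : 0 ≤ K := by positivity
  -- termwise bound
  have hterm : ∀ y₂ ∈ C, term162 g δ₀ y₁ y₂ ≤ K * Real.exp (-(c * δ₀ * g.dist y₁ y₂)) := by
    intro y₂ hy₂
    unfold term162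
    set t := g.dist y₁ y₂ with ht
    have ht0 : 0 ≤ t := hdist y₂ hy₂
    have hsc := hscale y₂ hy₂
    obtain ⟨m, hm⟩ : ∃ m : ℕ, g.k = g.scale y₂ + m := ⟨g.k - g.scale y₂, by omega⟩
    -- the weight (L^{j₂}η)^{-1} ≤ L^{k - j₂} = L^m
    have hlenpos : 0 < g.len y₂ := by unfold B6.Geometry.len; positivity
    have hprod : 1 ≤ g.len y₂ * g.L ^ m := by
      calc (1 : ℝ) ≤ g.L ^ g.k * g.eta := hnorm
        _ = g.len y₂ * g.L ^ m := by unfold B6.Geometry.len; rw [hm, pow_add]; ring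
    have hlen : (g.len y₂)⁻¹ ≤ g.L ^ m :=
      calc (g.len y₂)⁻¹ = (g.len y₂)⁻¹ * 1 := (mul_one _).symm
        _ ≤ (g.len y₂)⁻¹ * (g.len y₂ * g.L ^ m) :=
            mul_le_mul_of_nonneg_left hprod (inv_pos.mpr hlenpos).le
        _ = g.L ^ m := by rw [← mul_assoc, inv_mul_cancel₀ hlenpos.ne', one_mul]
    -- split the exponential e^{-½δ₀t} ≤ e^{-aδ₀t} e^{-bδ₀t} e^{-cδ₀t}
    have hexp : Real.exp (-(δ₀ / 2 * t)) ≤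
        Real.exp (-(a * δ₀ * t)) * Real.exp (-(b * δ₀ * t)) * Real.exp (-(c * δ₀ * t)) := by
      rw [← Real.exp_add, ← Real.exp_add, Real.exp_le_exp]
      nlinarith [mul_nonneg (sub_nonneg.mpr habc) (mul_nonneg hδ₀.le ht0)]
    -- (i) scale compensation L^m e^{-aδ₀t} ≤ L^gap
    have hi : g.L ^ m * Real.exp (-(a * δ₀ * t)) ≤ g.L ^ gap := by
      by_cases hmg : m ≤ gap
      · have h1 : Real.exp (-(a * δ₀ * t)) ≤ 1 := by
          rw [Real.exp_le_one_iff]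
          nlinarith [mul_nonneg (mul_nonneg ha hδ₀.le) ht0]
        calc g.L ^ m * Real.exp (-(a * δ₀ * t)) ≤ g.L ^ m * 1 :=
              mul_le_mul_of_nonneg_left h1 (by positivity)
          _ ≤ g.L ^ gap := by rw [mul_one]; exact pow_le_pow_right₀ hL hmg
      · obtain ⟨n, hn⟩ : ∃ n : ℕ, m = gap + n := ⟨m - gap, by omega⟩
        have h60' : g.R * g.M * (n : ℝ) ≤ t := by
          have h := h60 y₂ hy₂
          have hcast : ((g.k : ℝ) - g.scale y₂ - gap) = (n : ℝ) := by
            rw [hm, hn]; push_cast; ring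
          rw [hcast] at h
          exact h
        have hq : Real.exp (-(a * δ₀ * t)) ≤ Real.exp (-(a * δ₀ * (g.R * g.M))) ^ n := by
          rw [← Real.exp_nat_mul, Real.exp_le_exp]
          nlinarith [mul_le_mul_of_nonneg_left h60' (mul_nonneg ha hδ₀.le)]
        rw [hn]
        exact scale_compensation hL (Real.exp_pos _).le hsmall (Real.exp_pos _).le gap n hq
    -- (ii) the polynomial factor
    have hii : (t + 1) * Real.exp (-(b * δ₀ * t)) ≤ 1 / (Real.exp 1 * (b * δ₀)) + 1 :=
      add_one_mul_exp_neg_le (by positivity) ht0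
    -- assemble
    have hA : 0 ≤ t + 1 := by linarith
    have hLm : 0 ≤ g.L ^ m := by positivity
    have step1 : Real.exp (-(δ₀ / 2 * t)) * (t + 1) * (g.len y₂)⁻¹ ≤
        (Real.exp (-(a * δ₀ * t)) * Real.exp (-(b * δ₀ * t)) * Real.exp (-(c * δ₀ * t))) *
          (t + 1) * g.L ^ m :=
      mul_le_mul (mul_le_mul_of_nonneg_right hexp hA) hlen (inv_pos.mpr hlenpos).le (by positivity)
    have step2 : (g.L ^ m * Real.exp (-(a * δ₀ * t))) * ((t + 1) * Real.exp (-(b * δ₀ * t))) ≤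
        g.L ^ gap * (1 / (Real.exp 1 * (b * δ₀)) + 1) :=
      mul_le_mul hi hii (mul_nonneg hA (Real.exp_pos _).le) (by positivity)
    calc Real.exp (-(δ₀ / 2 * t)) * (t + 1) * (g.len y₂)⁻¹
        ≤ (Real.exp (-(a * δ₀ * t)) * Real.exp (-(b * δ₀ * t)) * Real.exp (-(c * δ₀ * t))) *
            (t + 1) * g.L ^ m := step1
      _ = (g.L ^ m * Real.exp (-(a * δ₀ * t))) * ((t + 1) * Real.exp (-(b * δ₀ * t))) *
            Real.exp (-(c * δ₀ * t)) := by ring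
      _ ≤ g.L ^ gap * (1 / (Real.exp 1 * (b * δ₀)) + 1) * Real.exp (-(c * δ₀ * t)) :=
          mul_le_mul_of_nonneg_right step2 (Real.exp_pos _).le
      _ = K * Real.exp (-(c * δ₀ * t)) := by rw [hK]
  -- sum over ℭ
  calc sum162 g δ₀ C y₁ = ∑ y₂ ∈ C, term162 g δ₀ y₁ y₂ := rfl
    _ ≤ ∑ y₂ ∈ C, K * Real.exp (-(c * δ₀ * g.dist y₁ y₂)) := Finset.sum_le_sum hterm
    _ = K * ∑ y₂ ∈ C, Real.exp (-(c * δ₀ * g.dist y₁ y₂)) := by rw [Finset.mul_sum]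
    _ ≤ K * C₁ := mul_le_mul_of_nonneg_left h61 hK0

/-! ## Discharging (i)–(ii) from the printed shapes (2.60), (2.61) of Lemma 2.1 of [3] -/

/-- (2.60) ⇒ the layer-separation lower bound used in `sum162_le`: if `e^{−αδ₀d(y₁,y₂)} ≤ e^{−αδ₀RM max{|j₁−j₂|−1,0}}`
(`B6RandomWalk.Ineq260`, αδ₀ > 0, RM ≥ 0), the observation point has scale `j₁ ≥ k − (gap − 1)` and `j₂ ≤ k`, then
`RM·(k − j₂ − gap) ≤ d(y₁,y₂)`. [cite: Balaban1984PropagatorsII, (2.60) p.234] -/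
theorem dist_lower_of_ineq260 (g : B6.Geometry) (δ₀ α : ℝ) (hαδ : 0 < α * δ₀) (hRM : 0 ≤ g.R * g.M)
    (h260 : B6RandomWalk.Ineq260 g δ₀ α) (gap : ℕ) (y₁ y₂ : g.Site)
    (hy₁ : (g.k : ℝ) - g.scale y₁ ≤ (gap : ℝ) - 1) (hy₂ : g.scale y₂ ≤ g.k) :
    g.R * g.M * ((g.k : ℝ) - g.scale y₂ - gap) ≤ g.dist y₁ y₂ := by
  have h := h260 y₁ y₂
  rw [Real.exp_le_exp] at h
  have hy₂' : (g.scale y₂ : ℝ) ≤ g.k := by exact_mod_cast hy₂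
  have hmax : (g.k : ℝ) - g.scale y₂ - gap ≤ max (|(g.scale y₁ : ℝ) - g.scale y₂| - 1) 0 := by
    have h1 : (g.scale y₁ : ℝ) - g.scale y₂ ≤ |(g.scale y₁ : ℝ) - g.scale y₂| := le_abs_self _
    have h2 : (g.k : ℝ) - g.scale y₂ - gap ≤ |(g.scale y₁ : ℝ) - g.scale y₂| - 1 := by linarith
    exact h2.trans (le_max_left _ _)
  have h2 : α * δ₀ * (g.R * g.M * max (|(g.scale y₁ : ℝ) - g.scale y₂| - 1) 0) ≤
      α * δ₀ * g.dist y₁ y₂ := by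
    have : α * δ₀ * (g.R * g.M * max (|(g.scale y₁ : ℝ) - g.scale y₂| - 1) 0) =
        α * δ₀ * g.R * g.M * max (|(g.scale y₁ : ℝ) - g.scale y₂| - 1) 0 := by ring
    linarith
  have h3 : g.R * g.M * max (|(g.scale y₁ : ℝ) - g.scale y₂| - 1) 0 ≤ g.dist y₁ y₂ :=
    le_of_mul_le_mul_left h2 hαδ
  calc g.R * g.M * ((g.k : ℝ) - g.scale y₂ - gap)
      ≤ g.R * g.M * max (|(g.scale y₁ : ℝ) - g.scale y₂| - 1) 0 := mul_le_mul_of_nonneg_left hmax hRM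
    _ ≤ g.dist y₁ y₂ := h3

/-- (2.61) ⇒ the row sum over any ℭ ⊆ 𝔅 (`B6RandomWalk.Ineq261`: the full row sum over 𝔅 is ≤ c₁(α); the terms are
positive). [cite: Balaban1984PropagatorsII, (2.61) p.234] -/
theorem sum_le_of_ineq261 (d : ℕ) (g : B6.Geometry) (δ₀ α : ℝ) (h261 : B6RandomWalk.Ineq261 d g δ₀ α)
    (C : Finset g.Site) (y₁ : g.Site) :
    ∑ y₂ ∈ C, Real.exp (-(α * δ₀ * g.dist y₁ y₂)) ≤ B6.c1 d δ₀ α :=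
  (Finset.sum_le_sum_of_subset_of_nonneg (Finset.subset_univ C)
    (fun _ _ _ => (Real.exp_pos _).le)).trans (h261 y₁)

/-- **(162) from Lemma 2.1 of [3]** — the print's "It follows from the inequalities (2.47)–(2.51) of [3] that B₃ depends
on d and L only", with the tree's `B6.Lemma21Printed d δ₀ geo` as HYPOTHESIS, used at α = ⅛ (split (a,b,c) = (¼,⅛,⅛)):
for a situation `i` satisfying (2.1)–(2.2) (`Hyp21_22`) and (2.59) at α = ⅛, with L ≥ 1, η > 0, L^kη ≥ 1, RM ≥ 0, scales
≤ k, d ≥ 0, and the LOCATED SMALLNESS `log L ≤ ¼δ₀RM` (cell row G-pv21-1; not displayed in print), every observation point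
of scale allowance `gap` and every finite ℭ: `Σ_{y₂∈ℭ} e^{−½δ₀d}(d+1)(L^{j₂}η)^{−1} ≤ L^{gap}(8/(eδ₀) + 1)c₁(⅛)`.
[cite: Balaban1985Variational, (162) p.303; Balaban1984PropagatorsII, Lemma 2.1 p.234] -/
theorem sum162_le_of_lemma21 {I : Type} (d : ℕ) (δ₀ : ℝ) (geo : I → B6.Geometry)
    (h21 : B6.Lemma21Printed d δ₀ geo) (hδ₀ : 0 < δ₀) (gap : ℕ) (i : I)
    (hH : (geo i).Hyp21_22) (h259 : B6.Cond259 d δ₀ (1 / 8) (geo i).R (geo i).M)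
    (hL : 1 ≤ (geo i).L) (heta : 0 < (geo i).eta) (hnorm : 1 ≤ (geo i).L ^ (geo i).k * (geo i).eta)
    (hRM : 0 ≤ (geo i).R * (geo i).M)
    (hlog : Real.log (geo i).L ≤ 1 / 4 * δ₀ * ((geo i).R * (geo i).M))
    (hscale : ∀ y, (geo i).scale y ≤ (geo i).k) (hdist : ∀ y y', 0 ≤ (geo i).dist y y')
    (y₁ : (geo i).Site) (hy₁ : ((geo i).k : ℝ) - (geo i).scale y₁ ≤ (gap : ℝ) - 1)
    (C : Finset (geo i).Site) :
    sum162 (geo i) δ₀ C y₁ ≤ (geo i).L ^ gap * (8 / (Real.exp 1 * δ₀) + 1) * B6.c1 d δ₀ (1 / 8) := by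
  have h18 : (0 : ℝ) < 1 / 8 := by norm_num
  obtain ⟨h260, h261⟩ :=
    (B6RandomWalk.lemma21Printed_iff d δ₀ geo).mp h21 i hH (1 / 8) h18 (by norm_num) h259
  have hL0 : 0 < (geo i).L := by linarith
  have hmain := sum162_le (geo i) δ₀ (1 / 4) (1 / 8) (1 / 8) (B6.c1 d δ₀ (1 / 8)) gap C y₁ hδ₀
    (by norm_num) h18 h18.le (by norm_num) hL heta hnorm (fun y₂ _ => hscale y₂) (fun y₂ _ => hdist y₁ y₂)
    (fun y₂ _ => dist_lower_of_ineq260 (geo i) δ₀ (1 / 8) (by positivity) hRM h260 gap y₁ y₂ hy₁ (hscale y₂))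
    (sum_le_of_ineq261 d (geo i) δ₀ (1 / 8) h261 C y₁) (smallness_of_log hL0 hlog)
  have hconst : 1 / (Real.exp 1 * (1 / 8 * δ₀)) = 8 / (Real.exp 1 * δ₀) := by
    have he : Real.exp 1 ≠ 0 := (Real.exp_pos 1).ne'
    field_simp
  rw [hconst] at hmain
  exact hmain

/-- **`Claim162` concluded** for a family of situations with common (d, L, δ₀): under `B6.Lemma21Printed d δ₀ geo`
(hypothesis) and, for every member, (2.1)–(2.2), (2.59) at α = ⅛, L^kη ≥ 1, η > 0, RM ≥ 0, scales ≤ k, d ≥ 0 and the located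
smallness `log L ≤ ¼δ₀RM`, the double supremum of (162) over admissible observation points (scale allowance `gap`) is
≤ S := L^{gap}(8/(eδ₀) + 1)c₁(⅛) — "B₃ = 72d³L³B₀·S depends on d and L only" (given δ₀ = δ₀(d, L) of [3]).
[cite: Balaban1985Variational, (162) p.303; Balaban1984PropagatorsII, Lemma 2.1 p.234] -/
theorem claim162_of_lemma21 {I : Type} (d : ℕ) (δ₀ L : ℝ) (gap : ℕ) (geo : I → B6.Geometry)
    (h21 : B6.Lemma21Printed d δ₀ geo) (hδ₀ : 0 < δ₀) (hL : 1 ≤ L)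
    (hgeo : ∀ i, (geo i).Hyp21_22 ∧ (geo i).L = L ∧ 0 < (geo i).eta ∧
      1 ≤ (geo i).L ^ (geo i).k * (geo i).eta ∧ 0 ≤ (geo i).R * (geo i).M ∧
      B6.Cond259 d δ₀ (1 / 8) (geo i).R (geo i).M ∧
      Real.log L ≤ 1 / 4 * δ₀ * ((geo i).R * (geo i).M) ∧
      (∀ y, (geo i).scale y ≤ (geo i).k) ∧ (∀ y y', 0 ≤ (geo i).dist y y')) :
    Claim162 δ₀ geo (fun i y₁ => ((geo i).k : ℝ) - (geo i).scale y₁ ≤ (gap : ℝ) - 1) := by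
  refine ⟨L ^ gap * (8 / (Real.exp 1 * δ₀) + 1) * B6.c1 d δ₀ (1 / 8), fun i y₁ hy₁ C => ?_⟩
  obtain ⟨hH, hLi, heta, hnorm, hRM, h259, hlog, hscale, hdist⟩ := hgeo i
  have hL' : 1 ≤ (geo i).L := by rw [hLi]; exact hL
  have hlog' : Real.log (geo i).L ≤ 1 / 4 * δ₀ * ((geo i).R * (geo i).M) := by rw [hLi]; exact hlog
  have h := sum162_le_of_lemma21 d δ₀ geo h21 hδ₀ gap i hH h259 hL' heta hnorm hRM hlog' hscale hdist y₁ hy₁ C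
  rw [hLi] at h
  exact h

/-! ## Bookkeeping around (161)–(164) and the necessity of the located smallness -/

/-- 72 = 4·18: if the inner sum of (162) is ≤ S then the right side of (161), `18d³L³B₀·Σ·X` (X = M_Δ max{ε₁,
e^{−½δ₀R₁M₁}ε₀} ≥ 0, P = d³L³B₀ ≥ 0), is ≤ ¼·(72·P·S)·X = ¼B₃·X — the form in which (161) enters (163)–(164)
(cell row C-B11-F1). [cite: Balaban1985Variational, (161)–(164) pp.303–304] -/
theorem ineq161_le_quarter_B3 (P sm S X : ℝ) (hP : 0 ≤ P) (hX : 0 ≤ X) (hsm : sm ≤ S) :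
    18 * P * sm * X ≤ 1 / 4 * (72 * P * S) * X := by
  have h1 : 18 * P * sm ≤ 18 * P * S := mul_le_mul_of_nonneg_left hsm (by positivity)
  nlinarith [mul_le_mul_of_nonneg_right h1 hX]

/-- Each summand of (162) is ≥ 0 (d ≥ 0, block lengths > 0), so the sum majorises any single term. [folklore] -/
theorem term162_le_sum162 (g : B6.Geometry) (δ₀ : ℝ) (C : Finset g.Site) (y₁ y₂ : g.Site) (hy₂ : y₂ ∈ C)
    (hdist : ∀ y ∈ C, 0 ≤ g.dist y₁ y) (hlen : ∀ y ∈ C, 0 < g.len y) :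
    term162 g δ₀ y₁ y₂ ≤ sum162 g δ₀ C y₁ := by
  refine Finset.single_le_sum (f := fun y => term162 g δ₀ y₁ y) (fun y hy => ?_) hy₂
  unfold term162
  have h1 := hdist y hy
  have h2 := hlen y hy
  exact mul_nonneg (mul_nonneg (Real.exp_pos _).le (by linarith)) (inv_pos.mpr h2).le

/-- **Necessity of the located smallness** (why "R₁M₁ large compared with log L" is implicit in (162)): with the
normalisation L^kη = 1, one point y₂ ∈ ℭ of scale 0 (y₂ ∈ Λ′₀ ⊂ □₀) at multiscale distance ≤ RM(k+1) + D₀ from y₁ already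
gives `sum162 ≥ e^{−½δ₀(RM + D₀)}·(L·e^{−½δ₀RM})^k`; hence a bound uniform in k forces L·e^{−½δ₀R₁M₁} < 1 (up to the
neglected factor d + 1), i.e. ½δ₀R₁M₁ > log L. [cite: Balaban1985Variational, (162) p.303] -/
theorem divergence_witness (g : B6.Geometry) (δ₀ D₀ : ℝ) (C : Finset g.Site) (y₁ y₂ : g.Site)
    (hδ₀ : 0 ≤ δ₀) (hL : 1 ≤ g.L) (heta : 0 < g.eta) (hnorm : g.L ^ g.k * g.eta = 1) (hy₂ : y₂ ∈ C)
    (hs : g.scale y₂ = 0) (hdist : ∀ y ∈ C, 0 ≤ g.dist y₁ y)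
    (hD : g.dist y₁ y₂ ≤ g.R * g.M * (g.k + 1) + D₀) :
    Real.exp (-(δ₀ / 2 * (g.R * g.M + D₀))) * (g.L * Real.exp (-(δ₀ / 2 * (g.R * g.M)))) ^ g.k
      ≤ sum162 g δ₀ C y₁ := by
  have hL0 : 0 < g.L := by linarith
  have hlenpos : ∀ y ∈ C, 0 < g.len y := fun y _ => by unfold B6.Geometry.len; positivity
  refine le_trans ?_ (term162_le_sum162 g δ₀ C y₁ y₂ hy₂ hdist hlenpos)
  unfold term162
  have hlenk : (g.len y₂)⁻¹ = g.L ^ g.k := by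
    have hprod : g.len y₂ * g.L ^ g.k = 1 := by
      unfold B6.Geometry.len
      rw [hs, pow_zero, one_mul, mul_comm]
      exact hnorm
    have hne : g.len y₂ ≠ 0 := fun h0 => by rw [h0, zero_mul] at hprod; exact zero_ne_one hprod
    exact (mul_eq_one_iff_inv_eq₀ hne).mp hprod
  rw [hlenk]
  set t := g.dist y₁ y₂ with ht
  have ht0 : 0 ≤ t := hdist y₂ hy₂
  have hexp : Real.exp (-(δ₀ / 2 * (g.R * g.M + D₀))) * Real.exp (-(δ₀ / 2 * (g.R * g.M))) ^ g.k ≤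
      Real.exp (-(δ₀ / 2 * t)) := by
    rw [← Real.exp_nat_mul, ← Real.exp_add, Real.exp_le_exp]
    nlinarith [mul_le_mul_of_nonneg_left hD (by linarith : 0 ≤ δ₀ / 2)]
  calc Real.exp (-(δ₀ / 2 * (g.R * g.M + D₀))) * (g.L * Real.exp (-(δ₀ / 2 * (g.R * g.M)))) ^ g.k
      = (Real.exp (-(δ₀ / 2 * (g.R * g.M + D₀))) * Real.exp (-(δ₀ / 2 * (g.R * g.M))) ^ g.k) * 1 *
          g.L ^ g.k := by rw [mul_pow]; ring
    _ ≤ Real.exp (-(δ₀ / 2 * t)) * (t + 1) * g.L ^ g.k := by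
        apply mul_le_mul_of_nonneg_right _ (by positivity)
        exact mul_le_mul hexp (by linarith) zero_le_one (Real.exp_pos _).le

end Literature.MathematicalPhysics.QuantumFieldTheory.Balaban1983to89.B11B3
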